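import Summits.KontsevichZagierPeriods.KontsevichZagierPeriods.Theses.MarkovTreeOfMoves

/-!
# `PeriodSequenceMove` (stmt-KontsevichZagierPeriods-4541, route MarkovTreeOfMoves, rank 3) — birth skeleton

Crux (sector Conjecture 1 in functional form): for Laurent polynomials `f, g ∈ ℚ[x₁^±,…,x_n^±]` with
equal period sequences `CT(fᵏ) = CT(gᵏ)` (all `k`) and every honest rational `t₀` (`|t₀ f|, |t₀ g| < 1`
on the unit torus), the torus-period representations `R_f(t₀) = [ℝⁿ, J(u)·Re(1/(1 − t₀ f(x(u))))]` and
`R_g(t₀)` (tan-half-angle chart `x(u)`, Haar density `J`) are KZ-equivalent.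

Line `birth` = the route header's "unconditional attack: Picard–Fuchs transport from the trivial fibre
`t = 0`", cut into three named pieces (sorries live ONLY in the three `stub_*` theorems):

* `stub_valueShadow` (V, M/L, provable): equal period sequences ⇒ equal VALUES at every honest
  rational parameter (uniformly convergent geometric series on the torus + orthogonality of characters
  in the `u`-chart) — the period difference vanishes as a function, the input of any transport.
* `stub_trivialFibreTransport` (T, L, provable): at `t = 0` both representations are literally
  `[ℝⁿ, J]`; two rule-3 moves along the normalised parameter `τ ∈ [0,1]` (`t = t₀τ`) and rule 1b give
  `[R_f(t₀)] − [R_g(t₀)] − [S] ∈ KZ.relations` for the slab `S = [ℝⁿ × [0,1], ∂_τ(F_f − F_g)(u,t₀τ)]`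
  (explicit rational integrand), including the existence of `S`.
* `stub_flatSlabTransport` (F, XL, the heart): identically vanishing period difference on the honest
  rationals ⇒ `[S] ∈ KZ.relations` — the transfer of the crux to an exact `τ`-derivative on an
  `(n+1)`-slab with a function-level hypothesis, where common Picard–Fuchs annihilators with rational
  creative-telescoping certificates (Lairez2015, BostanLairezSalvy2013) and the route's one-directional
  Stokes block can act; open difficulty named in its docstring (MUM point at `t = 0`, transcendental
  integrating factors for `ord L ≥ 2`; order 1 closes).

Composition (sorry-free): `PeriodSequenceMove_of_stubs : V → T → F → (crux, unfolded verbatim)` —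
take the slab `S` and the relation `[r] − [r'] − [S]` from T, kill `[S]` by F fed with V, and add in
`KZ.relations`; `PeriodSequenceMove_of : PeriodSequenceMove` applies it to the three stubs BY NAME (the
only theorem of this file whose conclusion is the route decl, as `#h21_check_skeleton` requires).

Why this cut and not the mutation dictionary: `MutationIsAMove` yields equivalence only for
`|t₀| < δ(mutation)`, and intermediate polynomials of a mutation chain need not be honest at a given
`t₀`, so even on mutation-complete classes the passage from small `t₀` to every honest `t₀` is a
transport in the parameter — the slab `S` is unavoidable; the dictionary re-enters as a tool for F
(germ at the MUM point) rather than as a stub that would be false off rigid-MMLP classes (coverings: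
`f(x,y)` vs `f(x,y²)`). Checked against the simplest pair `f = x + 1/x`, `g = f(2x)`: the fibre
integrand `F_f − F_g` is NOT `u`-exact with a semialgebraic primitive (log primitives: the barrier
`Literature.Barriers.KontsevichZagierPeriods.noSemialgebraicPrimitive_inv_sub_two` pattern), which is why
F is stated for the `τ`-derivative slab after applying an annihilator, not as fibrewise exactness.
Disproof used: none on file for this crux (no `Disproof.lean`, no dead lines; `ledger negatives` for the
summit has no Laurent/torus statement). All statements are over existing declarations only
(`Literature.NumberTheory.Transcendental.KZ.*`, Mathlib) with the crux's own pinning of `ev`, `tc`, `J`.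
-/

set_option linter.dupNamespace false

namespace Summit.KontsevichZagierPeriods.KontsevichZagierPeriods.Cruxes.PeriodSequenceMove.Birth

open Summit.KontsevichZagierPeriods.KontsevichZagierPeriods.Theses.MarkovTreeOfMoves (PeriodSequenceMove)

/-- **Stub V — `valueShadow` (the integer shadow at function level; analysis, size M/L).**
For Laurent polynomials `f, g` over `ℚ` with equal period sequences `CT(f^k) = CT(g^k)` and every
HONEST rational parameter `t` (`|t f|, |t g| < 1` on the unit torus), the torus-period
representations `R_f(t) = [ℝⁿ, J·Re(1/(1 − t f(x(u))))]` and `R_g(t)` have the same value.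
Proof plan: honesty + compactness of the torus give `max |t f| < 1`, so the geometric series
`Σ tᵏ fᵏ` converges uniformly on the torus; termwise integration and the orthogonality of characters
in the tan-half-angle chart, `∫_{ℝⁿ} J(u)·Re(x(u)^v) du = (2π)ⁿ·[v = 0]` (the value shadow of the
route support `ConstantTermMove`), give `value R_f(t) = (2π)ⁿ Σ CT(fᵏ) tᵏ`. This is the input of
every Picard–Fuchs / Gauss–Manin transport: the period DIFFERENCE vanishes as a FUNCTION on the
honest interval, not just at `t₀`. Consequence of the crux as well (relations ≤ ker eval), used
TOWARD it by `stub_flatSlabTransport`. [AkhtarCoatesGalkinKasprzyk2012 Lemma 1 (value level),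
KontsevichZagier2001 §1.1] -/
theorem stub_valueShadow :
    ∀ (n : ℕ) (ev : AddMonoidAlgebra ℚ (Fin n → ℤ) → (Fin n → ℂ) → ℂ) (tc : (Fin n → ℝ) → (Fin n → ℂ)) (J : (Fin n → ℝ) → ℝ), (∀ f x, ev f x = f.coeff.sum (fun v c => (c : ℂ) * ∏ i, x i ^ (v i))) → (∀ u i, tc u i = (((1 - u i ^ 2 : ℝ) : ℂ) + ((2 * u i : ℝ) : ℂ) * Complex.I) / ((1 + u i ^ 2 : ℝ) : ℂ)) → (∀ u, J u = ∏ i, 2 / (1 + u i ^ 2)) → ∀ (f g : AddMonoidAlgebra ℚ (Fin n → ℤ)), (∀ k : ℕ, (f ^ k).coeff 0 = (g ^ k).coeff 0) → ∀ t : ℚ, (∀ x : Fin n → ℂ, (∀ i, ‖x i‖ = 1) → ‖((t : ℚ) : ℂ) * ev f x‖ < 1 ∧ ‖((t : ℚ) : ℂ) * ev g x‖ < 1) → ∀ (r r' : Literature.NumberTheory.Transcendental.KZ.IntegralRep n), r.domain = Set.univ → (∀ u, r.integrand u = J u * (1 / (1 - ((t : ℚ) : ℂ) * ev f (tc u))).re)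 → r'.domain = Set.univ → (∀ u, r'.integrand u = J u * (1 / (1 - ((t : ℚ) : ℂ) * ev g (tc u))).re) → r.value = r'.value := by
  sorry

/-- **Stub T — `trivialFibreTransport` (move engineering, provable now, size L).**
At `t = 0` the two representations coincide LITERALLY (`R_f(0) = R_g(0) = [ℝⁿ, J]`). Two
Newton–Leibniz moves (rule 3) along the normalised parameter `τ ∈ [0,1]` over the base `ℝⁿ`, with
the semialgebraic (indeed `ℚ`-rational) primitives `F_f(u, t₀τ) = J(u)·Re(1/(1 − t₀τ f(x(u))))` and
`F_g`, plus integrand additivity (rule 1b) to cancel the two copies of `[ℝⁿ, J]`, give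
`[R_f(t₀)] − [R_g(t₀)] − [S] ∈ KZ.relations` for the SLAB representation
`S = [ℝⁿ × [0,1], ∂_τ(F_f − F_g)(u, t₀τ)]`, whose integrand is the explicit rational function
`J(u)·Re(t₀ f/(1 − t₀τ f)² − t₀ g/(1 − t₀τ g)²)(x(u))`. Existence of `S` (semialgebraicity of the real
part of a `ℚ(i)`-rational function of `u`, integrability from honesty: `|1 − t₀τ f| ≥ 1 − max|t₀ f| > 0`
uniformly on the slab since `|t₀ τ| ≤ |t₀|`) is part of the statement. No period-sequence hypothesis
is needed here. [KontsevichZagier2001 §1.2 rules (1b), (3); the `LegendreModulusPropagation` pattern of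
route GaussManinCertificates] -/
theorem stub_trivialFibreTransport :
    ∀ (n : ℕ) (ev : AddMonoidAlgebra ℚ (Fin n → ℤ) → (Fin n → ℂ) → ℂ) (tc : (Fin n → ℝ) → (Fin n → ℂ)) (J : (Fin n → ℝ) → ℝ), (∀ f x, ev f x = f.coeff.sum (fun v c => (c : ℂ) * ∏ i, x i ^ (v i))) → (∀ u i, tc u i = (((1 - u i ^ 2 : ℝ) : ℂ) + ((2 * u i : ℝ) : ℂ) * Complex.I) / ((1 + u i ^ 2 : ℝ) : ℂ)) → (∀ u, J u = ∏ i, 2 / (1 + u i ^ 2)) → ∀ (f g : AddMonoidAlgebra ℚ (Fin n → ℤ)) (t₀ : ℚ), (∀ x : Fin n → ℂ, (∀ i, ‖x i‖ = 1) → ‖((t₀ : ℚ) : ℂ) * ev f x‖ < 1 ∧ ‖((t₀ : ℚ) : ℂ) * ev g x‖ < 1) → ∀ (r r' : Literature.NumberTheory.Transcendental.KZ.IntegralRep n), r.domain = Set.univ → (∀ u, r.integrand u = J u * (1 / (1 - ((t₀ : ℚ) : ℂ) * ev f (tc u))).re) → r'.domain = Set.univ → (∀ u, r'.integrand u = J u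 * (1 / (1 - ((t₀ : ℚ) : ℂ) * ev g (tc u))).re) → ∃ s : Literature.NumberTheory.Transcendental.KZ.IntegralRep (n + 1), s.domain = {z : Fin (n + 1) → ℝ | 0 ≤ z (Fin.last n) ∧ z (Fin.last n) ≤ 1} ∧ (∀ z : Fin (n + 1) → ℝ, s.integrand z = J (Fin.init z : Fin n → ℝ) * (((t₀ : ℚ) : ℂ) * (ev f (tc (Fin.init z : Fin n → ℝ)) / (1 - ((t₀ : ℚ) : ℂ) * ((z (Fin.last n) : ℝ) : ℂ) * ev f (tc (Fin.init z : Fin n → ℝ))) ^ 2 - ev g (tc (Fin.init z : Fin n → ℝ)) / (1 - ((t₀ : ℚ) : ℂ) * ((z (Fin.last n) : ℝ) : ℂ) * ev g (tc (Fin.init z : Fin n → ℝ))) ^ 2)).re) ∧ Literature.NumberTheory.Transcendental.KZ.of r - Literature.NumberTheory.Transcendental.KZ.of r' - Literature.NumberTheory.Transcendental.KZ.of s ∈ Literature.NumberTheory.Transcendental.KZ.relations := by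
  sorry

/-- **Stub F — `flatSlabTransport` (the HEART, size XL; Picard–Fuchs transport from the trivial
fibre, stated at function level).** If the period difference `t ↦ value R_f(t) − value R_g(t)`
vanishes at EVERY honest rational `t` (hence identically on the honest interval, by continuity), then
for every honest rational `t₀` the slab representation `S = [ℝⁿ × [0,1], ∂_τ(F_f − F_g)(u, t₀τ)]` lies
in `KZ.relations`. TRANSFER of the crux (equivalent to it given stubs V and T, both theorems-to-be):
the numerical coincidence at `t₀` is replaced by an identically vanishing PERIOD FUNCTION of a
one-parameter family of rational integrands, and the target by an `(n+1)`-dimensional representation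
whose integrand is an exact `τ`-derivative — the setting in which creative-telescoping certificates
`L·(1/(1 − t f)) = Σᵢ ∂_{θᵢ}(Cᵢ/(1 − t f)^N)` (common annihilator `L ∈ ℚ[t]⟨∂_t⟩` of both classes,
rational certificates: Lairez2015, BostanLairezSalvy2013 Thm 12) and semialgebraic Stokes in the
`u`-directions (split at `|uᵢ| = 1`, chart `v = 1/uᵢ`, two rule-3 moves — the route's one-directional
block) act. Known obstruction = the crux's own risk: `t = 0` is a singular (MUM) point of `L` and for
`ord L ≥ 2` the integrating factors are transcendental (order 1 with no singular point of `L` on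
`[0, t₀]`: `π_f` is then algebraic and positive on the honest interval, the integrating factor `1/π_f`
normalised at `t₀` is semialgebraic, and one further rule-3 move in `t` closes the transport — the
genuine special case). Implied by the summit
(the slab is an `IsRational` representation of value 0). [Lairez2015, BostanLairezSalvy2013,
CoatesKasprzykPittonTveiten2021, KontsevichZagier2001 §1.2] -/
theorem stub_flatSlabTransport :
    ∀ (n : ℕ) (ev : AddMonoidAlgebra ℚ (Fin n → ℤ) → (Fin n → ℂ) → ℂ) (tc : (Fin n → ℝ) → (Fin n → ℂ)) (J : (Fin n → ℝ) → ℝ), (∀ f x, ev f x = f.coeff.sum (fun v c => (c : ℂ) * ∏ i, x i ^ (v i))) → (∀ u i, tc u i = (((1 - u i ^ 2 : ℝ) : ℂ) + ((2 * u i : ℝ) : ℂ) * Complex.I) / ((1 + u i ^ 2 : ℝ) : ℂ)) → (∀ u, J u = ∏ i, 2 / (1 + u i ^ 2)) → ∀ (f g : AddMonoidAlgebra ℚ (Fin n → ℤ)), (∀ t : ℚ, (∀ x : Fin n → ℂ, (∀ i, ‖x i‖ = 1) → ‖((t : ℚ) : ℂ) * ev f x‖ < 1 ∧ ‖((t : ℚ)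 : ℂ) * ev g x‖ < 1) → ∀ (r r' : Literature.NumberTheory.Transcendental.KZ.IntegralRep n), r.domain = Set.univ → (∀ u, r.integrand u = J u * (1 / (1 - ((t : ℚ) : ℂ) * ev f (tc u))).re) → r'.domain = Set.univ → (∀ u, r'.integrand u = J u * (1 / (1 - ((t : ℚ) : ℂ) * ev g (tc u))).re) → r.value = r'.value) → ∀ t₀ : ℚ, (∀ x : Fin n → ℂ, (∀ i, ‖x i‖ = 1) → ‖((t₀ : ℚ) : ℂ) * ev f x‖ < 1 ∧ ‖((t₀ : ℚ) : ℂ) * ev g x‖ < 1) → ∀ s : Literature.NumberTheory.Transcendental.KZ.IntegralRep (n + 1), s.domain = {z : Fin (n + 1) → ℝ | 0 ≤ z (Fin.last n) ∧ z (Fin.last n) ≤ 1} → (∀ z : Fin (n + 1) → ℝ, s.integrand z = J (Fin.init z : Fin n → ℝ) * (((t₀ : ℚ) : ℂ) * (ev f (tc (Fin.init z : Fin n → ℝ)) / (1 - ((t₀ : ℚ) : ℂ) * ((z (Fin.last n) : ℝ) : ℂ) * ev f (tc (Fin.init z : Fin n → ℝ))) ^ 2 - ev g (tc (Fin.init z :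 Fin n → ℝ)) / (1 - ((t₀ : ℚ) : ℂ) * ((z (Fin.last n) : ℝ) : ℂ) * ev g (tc (Fin.init z : Fin n → ℝ))) ^ 2)).re) → Literature.NumberTheory.Transcendental.KZ.of s ∈ Literature.NumberTheory.Transcendental.KZ.relations := by
  sorry

/-! ## The composition (sorry-free) -/

/-- The composition, arrow form: VALUE SHADOW → TRIVIAL-FIBRE TRANSPORT → FLAT SLAB TRANSPORT → the
crux (conclusion = `PeriodSequenceMove` UNFOLDED verbatim, so that exactly one theorem of this file,
`PeriodSequenceMove_of`, concludes the crux by its route name). Pure bookkeeping in `KZ.relations`: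
`[r] − [r'] = ([r] − [r'] − [S]) + [S]`. [KontsevichZagier2001 §1.2] -/
theorem PeriodSequenceMove_of_stubs :
    (∀ (n : ℕ) (ev : AddMonoidAlgebra ℚ (Fin n → ℤ) → (Fin n → ℂ) → ℂ) (tc : (Fin n → ℝ) → (Fin n → ℂ)) (J : (Fin n → ℝ) → ℝ), (∀ f x, ev f x = f.coeff.sum (fun v c => (c : ℂ) * ∏ i, x i ^ (v i))) → (∀ u i, tc u i = (((1 - u i ^ 2 : ℝ) : ℂ) + ((2 * u i : ℝ) : ℂ) * Complex.I) / ((1 + u i ^ 2 : ℝ) : ℂ)) → (∀ u, J u = ∏ i, 2 / (1 + u i ^ 2)) → ∀ (f g : AddMonoidAlgebra ℚ (Fin n → ℤ)), (∀ k : ℕ, (f ^ k).coeff 0 = (g ^ k).coeff 0) → ∀ t : ℚ, (∀ x : Fin n → ℂ, (∀ i, ‖x i‖ = 1) → ‖((t : ℚ) : ℂ) * ev f x‖ < 1 ∧ ‖((t : ℚ) : ℂ) * ev g x‖ < 1) → ∀ (r r' : Literature.NumberTheory.Transcendental.KZ.IntegralRep n), r.domain = Set.univ → (∀ u, r.integrand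 u = J u * (1 / (1 - ((t : ℚ) : ℂ) * ev f (tc u))).re) → r'.domain = Set.univ → (∀ u, r'.integrand u = J u * (1 / (1 - ((t : ℚ) : ℂ) * ev g (tc u))).re) → r.value = r'.value) →
    (∀ (n : ℕ) (ev : AddMonoidAlgebra ℚ (Fin n → ℤ) → (Fin n → ℂ) → ℂ) (tc : (Fin n → ℝ) → (Fin n → ℂ)) (J : (Fin n → ℝ) → ℝ), (∀ f x, ev f x = f.coeff.sum (fun v c => (c : ℂ) * ∏ i, x i ^ (v i))) → (∀ u i, tc u i = (((1 - u i ^ 2 : ℝ) : ℂ) + ((2 * u i : ℝ) : ℂ) * Complex.I) / ((1 + u i ^ 2 : ℝ) : ℂ)) → (∀ u, J u = ∏ i, 2 / (1 + u i ^ 2)) → ∀ (f g : AddMonoidAlgebra ℚ (Fin n → ℤ)) (t₀ : ℚ), (∀ x : Fin n → ℂ, (∀ i, ‖x i‖ = 1) → ‖((t₀ : ℚ) : ℂ) * ev f x‖ < 1 ∧ ‖((t₀ : ℚ) : ℂ) * ev g x‖ < 1) → ∀ (r r' : Literature.NumberTheory.Transcendental.KZ.IntegralRep n), r.domain = Set.univ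 → (∀ u, r.integrand u = J u * (1 / (1 - ((t₀ : ℚ) : ℂ) * ev f (tc u))).re) → r'.domain = Set.univ → (∀ u, r'.integrand u = J u * (1 / (1 - ((t₀ : ℚ) : ℂ) * ev g (tc u))).re) → ∃ s : Literature.NumberTheory.Transcendental.KZ.IntegralRep (n + 1), s.domain = {z : Fin (n + 1) → ℝ | 0 ≤ z (Fin.last n) ∧ z (Fin.last n) ≤ 1} ∧ (∀ z : Fin (n + 1) → ℝ, s.integrand z = J (Fin.init z : Fin n → ℝ) * (((t₀ : ℚ) : ℂ) * (ev f (tc (Fin.init z : Fin n → ℝ)) / (1 - ((t₀ : ℚ) : ℂ) * ((z (Fin.last n) : ℝ) : ℂ) * ev f (tc (Fin.init z : Fin n → ℝ))) ^ 2 - ev g (tc (Fin.init z : Fin n → ℝ)) / (1 - ((t₀ : ℚ) : ℂ) * ((z (Fin.last n) : ℝ) : ℂ) * ev g (tc (Fin.init z : Fin n → ℝ))) ^ 2)).re) ∧ Literature.NumberTheory.Transcendental.KZ.of r - Literature.NumberTheory.Transcendental.KZ.of r' - Literature.NumberTheory.Transcendental.KZ.of s ∈ Literature.NumberTheory.Transcendental.KZ.relations)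 →
    (∀ (n : ℕ) (ev : AddMonoidAlgebra ℚ (Fin n → ℤ) → (Fin n → ℂ) → ℂ) (tc : (Fin n → ℝ) → (Fin n → ℂ)) (J : (Fin n → ℝ) → ℝ), (∀ f x, ev f x = f.coeff.sum (fun v c => (c : ℂ) * ∏ i, x i ^ (v i))) → (∀ u i, tc u i = (((1 - u i ^ 2 : ℝ) : ℂ) + ((2 * u i : ℝ) : ℂ) * Complex.I) / ((1 + u i ^ 2 : ℝ) : ℂ)) → (∀ u, J u = ∏ i, 2 / (1 + u i ^ 2)) → ∀ (f g : AddMonoidAlgebra ℚ (Fin n → ℤ)), (∀ t : ℚ, (∀ x : Fin n → ℂ, (∀ i, ‖x i‖ = 1) → ‖((t : ℚ) : ℂ) * ev f x‖ < 1 ∧ ‖((t : ℚ) : ℂ) * ev g x‖ < 1) → ∀ (r r' : Literature.NumberTheory.Transcendental.KZ.IntegralRep n), r.domain = Set.univ → (∀ u, r.integrand u = J u * (1 / (1 - ((t : ℚ) : ℂ) * ev f (tc u))).re) → r'.domain = Set.univ → (∀ u, r'.integrand u = J u * (1 / (1 - ((t : ℚ) : ℂ) * ev g (tc u))).re) → r.value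 = r'.value) → ∀ t₀ : ℚ, (∀ x : Fin n → ℂ, (∀ i, ‖x i‖ = 1) → ‖((t₀ : ℚ) : ℂ) * ev f x‖ < 1 ∧ ‖((t₀ : ℚ) : ℂ) * ev g x‖ < 1) → ∀ s : Literature.NumberTheory.Transcendental.KZ.IntegralRep (n + 1), s.domain = {z : Fin (n + 1) → ℝ | 0 ≤ z (Fin.last n) ∧ z (Fin.last n) ≤ 1} → (∀ z : Fin (n + 1) → ℝ, s.integrand z = J (Fin.init z : Fin n → ℝ) * (((t₀ : ℚ) : ℂ) * (ev f (tc (Fin.init z : Fin n → ℝ)) / (1 - ((t₀ : ℚ) : ℂ) * ((z (Fin.last n) : ℝ) : ℂ) * ev f (tc (Fin.init z : Fin n → ℝ))) ^ 2 - ev g (tc (Fin.init z : Fin n → ℝ)) / (1 - ((t₀ : ℚ) : ℂ) * ((z (Fin.last n) : ℝ) : ℂ) * ev g (tc (Fin.init z : Fin n → ℝ))) ^ 2)).re) → Literature.NumberTheory.Transcendental.KZ.of s ∈ Literature.NumberTheory.Transcendental.KZ.relations) →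
    ∀ (n : ℕ) (ev : AddMonoidAlgebra ℚ (Fin n → ℤ) → (Fin n → ℂ) → ℂ) (tc : (Fin n → ℝ) → (Fin n → ℂ)) (J : (Fin n → ℝ) → ℝ), (∀ f x, ev f x = f.coeff.sum (fun v c => (c : ℂ) * ∏ i, x i ^ (v i))) → (∀ u i, tc u i = (((1 - u i ^ 2 : ℝ) : ℂ) + ((2 * u i : ℝ) : ℂ) * Complex.I) / ((1 + u i ^ 2 : ℝ) : ℂ)) → (∀ u, J u = ∏ i, 2 / (1 + u i ^ 2)) → ∀ (f g : AddMonoidAlgebra ℚ (Fin n → ℤ)), (∀ k : ℕ, (f ^ k).coeff 0 = (g ^ k).coeff 0) → ∀ t₀ : ℚ, (∀ x : Fin n → ℂ, (∀ i, ‖x i‖ = 1) → ‖(t₀ : ℂ) * ev f x‖ < 1 ∧ ‖(t₀ : ℂ) * ev g x‖ < 1) → ∀ (r r' : Literature.NumberTheory.Transcendental.KZ.IntegralRep n), r.domain = Set.univ → (∀ u, r.integrand u = J u * (1 / (1 - (t₀ : ℂ) * ev f (tc u))).re) → r'.domain = Set.univ → (∀ u, r'.integrand u = J u * (1 / (1 -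 (t₀ : ℂ) * ev g (tc u))).re) → Literature.NumberTheory.Transcendental.KZ.Equivalent r r' := by
  intro hV hT hF n ev tc J hev htc hJ f g hk t₀ ht r r' hr hri hr' hr'i
  obtain ⟨s, hs, hsi, hrel⟩ := hT n ev tc J hev htc hJ f g t₀ ht r r' hr hri hr' hr'i
  have hsr : Literature.NumberTheory.Transcendental.KZ.of s ∈ Literature.NumberTheory.Transcendental.KZ.relations :=
    hF n ev tc J hev htc hJ f g
      (fun t htt ρ ρ' hρ hρi hρ' hρ'i => hV n ev tc J hev htc hJ f g hk t htt ρ ρ' hρ hρi hρ' hρ'i)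
      t₀ ht s hs hsi
  have key : Literature.NumberTheory.Transcendental.KZ.of r - Literature.NumberTheory.Transcendental.KZ.of r' = (Literature.NumberTheory.Transcendental.KZ.of r - Literature.NumberTheory.Transcendental.KZ.of r' - Literature.NumberTheory.Transcendental.KZ.of s) + Literature.NumberTheory.Transcendental.KZ.of s := by
    abel
  show Literature.NumberTheory.Transcendental.KZ.of r - Literature.NumberTheory.Transcendental.KZ.of r' ∈ Literature.NumberTheory.Transcendental.KZ.relations
  rw [key]
  exact add_mem hrel hsr

/-- **Skeleton theorem** (concludes the crux BY NAME): `PeriodSequenceMove` from the three declared stubs. -/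
theorem PeriodSequenceMove_of : PeriodSequenceMove :=
  PeriodSequenceMove_of_stubs stub_valueShadow stub_trivialFibreTransport stub_flatSlabTransport

end Summit.KontsevichZagierPeriods.KontsevichZagierPeriods.Cruxes.PeriodSequenceMove.Birth
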